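import Literature.AlgebraicGeometry.Resolution.BlowupStalkQuadraticTransform
import Literature.AlgebraicGeometry.Resolution.GenericPointStalkData
import Summits.ResolutionOfSingularities.ResolutionOfSingularities.Theorems.FrobeniusClosingSteerHironakaLUBranchOfCPPrelims
import Summits.ResolutionOfSingularities.ResolutionOfSingularities.Theorems.HilbertSamuelEliminationSigmaMaxModificationsCorridor3WLadderMovingIsoDefs
import HarnessLib

/-!
# [OURS · L1 W4.2] AN ISOLATED POINT TOWER, READ IN ONE FIELD, IS A TOWER OF QUADRATIC TRANSFORMS ALONG A VALUATION
# (step 2 of the scheme ↔ ring dictionary for the iso-kernel in Cossart–Piltant's frame)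

Crux chain w42 (`SigmaMaxModifications`, stmt-ResolutionOfSingularities-18506; conjunct `SigmaMaxModificationsCorridor3`, stmt-…-19249),
line `w_ladder`, registered stubs `stub_isoInsepTower` / `stub_isoSepRecurrent` of skeleton v8.6 (the residual of the isolated kernel
`IsoQuadraticTowerTerminates p 3`). Lead res-L1-w42-lead-1 (gen 5). Helper file `--supports stmt-ResolutionOfSingularities-19249`; kernel
only (no definition, no named fact).

WHAT IS PROVED. (§1, one step) For a blowing up `π : X' → X` of an integral locally Noetherian scheme along `J` with `J_{π x'} = 𝔪_{π x'}`
and INJECTIVE ring maps `θ : 𝒪_{X,π x'} → L`, `θ' : 𝒪_{X',x'} → L` into a field with `θ' ∘ π^♯_{x'} = θ`, if a valuation ring `O` of `L`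
DOMINATES `θ'(𝒪_{X',x'})` then `θ'(𝒪_{X',x'})` is THE quadratic transform of `θ(𝒪_{X,π x'})` along `O`
(`isQuadraticTransformAlong_range_of_stalk_embeddings`; from step 1 `IsBlowup.isQuadraticTransformAlong_range_stalkEmb`, Literature
`BlowupStalkQuadraticTransform.lean`, with `θ' = F ∘ ε_{x'}` by `IsBlowup.ringHom_ext_stalkMap`). (§2, towers) Along a tower of blow-ups
`T` with marked points `pt (n+1) ↦ pt n` and POINT centres `C_n = {pt n}` (the centre data of `IsIsoPointTower`), integral stages, and a
compatible family of injective stalk embeddings `θ n : 𝒪_{X_n, pt n} → L`: the images `θ n (𝒪_{X_n,pt n})` form an increasing chain of local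
subrings of `L`, each DOMINATING the previous one (`subringDominates_range_succ`), so Chevalley gives a valuation ring `O` dominating all of
them (res-type-026's `exists_valuationSubring_dominates`), and then EVERY step is the quadratic transform along `O`
(`exists_valuation_forall_isQuadraticTransformAlong_of_pointTower`) — exactly the tower shape `T : ℕ → Subring L`,
`IsQuadraticTransformAlong O (T i) (T (i+1))` consumed by `IdeasL1C5.false_of_hsIsolated_singular_pointTower_of_CP` (p547474).

HONEST FRAMING. OURS plumbing over folklore blow-up algebra (Stacks 0804, Cutkosky §2.2, Chevalley's extension theorem); nothing here is a
statement of H. Hironaka's manuscript [Hironaka2017] nor of [CossartJannsenSaito2020] / [CossartPiltant2019]. AI-written; AI review is weaker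
than expert review.

References: The Stacks Project, Tag 0804 [StacksProject]; S. D. Cutkosky (2014) §2.1–2.2 [Cutkosky2014]; H. Matsumura, *Commutative ring
theory*, Thm. 10.2 (Chevalley) [Matsumura1987].
-/

noncomputable section

set_option linter.dupNamespace false

open IsLocalRing AlgebraicGeometry CategoryTheory
open Literature.AlgebraicGeometry.Resolution Literature.AlgebraicGeometry.CossartJannsenSaito2020
open Scheme.IdealSheafData
open Summit.ResolutionOfSingularities.ResolutionOfSingularities.Cruxes.SigmaMaxModifications.IdeasL1Idea2R4 (IsIsoPointTower)
open Summit.ResolutionOfSingularities.ResolutionOfSingularities.Theorems.SwitchingDichotomy.HironakaLUBranchOfCP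
  (exists_valuationSubring_dominates)

namespace Summit.ResolutionOfSingularities.ResolutionOfSingularities.Cruxes.SigmaMaxModifications.IdeasL1C5

universe u

variable {L : Type u} [Field L]

/-! ## §0. Ranges of embeddings of local rings -/

/-- The image of a ring map precomposed with a ring isomorphism is the image. [folklore] -/
theorem range_comp_ringEquiv {A B : Type u} [CommRing A] [CommRing B] (f : B →+* L) (e : A ≃+* B) :
    (f.comp e.toRingHom).range = f.range := by
  ext z
  constructor
  · rintro ⟨a, rfl⟩; exact ⟨e a, rfl⟩
  · rintro ⟨b, rfl⟩; exact ⟨e.symm b, by simp⟩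

/-- For an INJECTIVE map of a local ring into a field, membership in the maximal ideal is read off the image subring. [folklore] -/
theorem mem_maximalIdeal_iff_range {A : Type u} [CommRing A] [IsLocalRing A] (θ : A →+* L) (hθ : Function.Injective θ)
    [IsLocalRing θ.range] (a : A) :
    a ∈ maximalIdeal A ↔ (⟨θ a, ⟨a, rfl⟩⟩ : θ.range) ∈ maximalIdeal θ.range := by
  let e : A ≃+* θ.range := RingEquiv.ofBijective θ.rangeRestrict ⟨fun x y h => hθ (congrArg Subtype.val h), θ.rangeRestrict_surjective⟩
  have hea : e a = ⟨θ a, ⟨a, rfl⟩⟩ := rfl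
  rw [IsLocalRing.mem_maximalIdeal, IsLocalRing.mem_maximalIdeal, mem_nonunits_iff, mem_nonunits_iff, ← hea]
  exact (isUnit_map_iff e a).not.symm

/-! ## §1. One step: both local rings embedded in `L`, the upper one dominated by `O` -/

section Step

variable {X' X : Scheme.{u}} {π : X' ⟶ X} {J : X.IdealSheafData} [IsIntegral X] [IsLocallyNoetherian X]

/-- **ONE STEP OF THE DICTIONARY, EMBEDDINGS FORM.** `π : X' → X` a blowing up of an integral locally Noetherian scheme along `J` with
`J_{π x'} = 𝔪_{π x'}`; `θ : 𝒪_{X,π x'} ↪ L`, `θ' : 𝒪_{X',x'} ↪ L` injective with `θ' ∘ π^♯_{x'} = θ`; `O` a valuation ring of `L` dominating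
`θ'(𝒪_{X',x'})`. Then `θ'(𝒪_{X',x'})` is the quadratic transform of `θ(𝒪_{X,π x'})` along `O`. [cite: StacksProject, Tag 0804] [cite: Cutkosky2014, §2.2] -/
theorem isQuadraticTransformAlong_range_of_stalk_embeddings (hπ : IsBlowup π J) (x' : X')
    (hJ : stalkIdeal J (π x') = maximalIdeal (X.presheaf.stalk (π x')))
    (θ : X.presheaf.stalk (π x') →+* L) (hθ : Function.Injective θ)
    (θ' : X'.presheaf.stalk x' →+* L) (hcomp : θ'.comp (π.stalkMap x').hom = θ)
    (O : ValuationSubring L) (hdom : SubringDominates θ'.range O.toSubring) :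
    IsQuadraticTransformAlong O θ.range θ'.range := by
  haveI : IsLocalRing θ.range := isLocalRing_of_range_eq θ _ rfl
  haveI : IsLocalRing θ'.range := isLocalRing_of_range_eq θ' _ rfl
  -- `θ = F ∘ (𝒪 ⊆ K(X))`, `θ' = F ∘ ε_{x'}`
  let F : X.functionField →+* L := IsFractionRing.lift hθ
  have hFθ : F.comp (algebraMap (X.presheaf.stalk (π x')) X.functionField) = θ :=
    RingHom.ext fun a => IsFractionRing.lift_algebraMap hθ a
  have hε : F.comp (hπ.stalkEmb x') = θ' := by
    refine hπ.ringHom_ext_stalkMap x' ?_ ?_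
    · rw [RingHom.comp_assoc, hπ.stalkEmb_comp_stalkMap, hFθ, hcomp]
    · rw [RingHom.comp_assoc, hπ.stalkEmb_comp_stalkMap, hFθ]
      exact hθ
  have hεr : ∀ r, F (hπ.stalkEmb x' r) = θ' r := fun r => RingHom.congr_fun hε r
  have hθ'inj : Function.Injective θ' := by
    rw [← hε]; exact F.injective.comp (hπ.stalkEmb_injective x')
  -- domination, unfolded
  have hO : ∀ r, F (hπ.stalkEmb x' r) ∈ O := fun r => by
    rw [hεr]; exact hdom.1 ⟨r, rfl⟩
  have hdomv := (subringDominates_valuationSubring_iff hdom.1).mp hdom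
  have hdom' : ∀ r, r ∈ maximalIdeal (X'.presheaf.stalk x') → O.valuation (F (hπ.stalkEmb x' r)) < 1 := by
    intro r hr
    rw [hεr]
    exact (hdomv ⟨θ' r, ⟨r, rfl⟩⟩).mp ((mem_maximalIdeal_iff_range θ' hθ'inj r).mp hr)
  have h := hπ.isQuadraticTransformAlong_range_stalkEmb_of_range_eq O x' hJ F θ hFθ θ.range rfl hO hdom'
  rwa [hε] at h

end Step

/-! ## §2. Towers: compatible stalk embeddings ⇒ a valuation ring dominating every stage, and every step a quadratic transform along it -/

section Tower

variable {T : BlowupTower.{u}} {pt : ∀ n, T.X n}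
  (hpt : ∀ n, (T.π n).base (pt (n + 1)) = pt n) (θ : ∀ n, (T.X n).presheaf.stalk (pt n) →+* L)

/-! A COMPATIBLE FAMILY OF STALK EMBEDDINGS along a tower with marked points `pt (n+1) ↦ pt n` is: injective ring maps
`θ n : 𝒪_{X_n, pt n} → L` with `θ (n+1) ∘ π_n^♯ = θ n`, the stalk of `X_n` at `π_n (pt (n+1))` being identified with the stalk at `pt n` along
the equality of points (`stalkCongr`) — hypotheses `hinj`, `hcomp` below. -/

/-- The embedding of the LOWER stalk at the image point `π_n (pt (n+1))`, transported from `pt n`, is injective. [folklore] -/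
theorem injective_comp_stalkCongr (hinj : ∀ n, Function.Injective (θ n)) (n : ℕ) :
    Function.Injective ((θ n).comp ((T.X n).presheaf.stalkCongr (.of_eq (hpt n))).hom.hom) :=
  (hinj n).comp ((T.X n).presheaf.stalkCongr (.of_eq (hpt n))).commRingCatIsoToRingEquiv.injective

/-- Transport along the equality of points does not change the image. [folklore] -/
theorem range_comp_stalkCongr (n : ℕ) :
    ((θ n).comp ((T.X n).presheaf.stalkCongr (.of_eq (hpt n))).hom.hom).range = (θ n).range :=
  range_comp_ringEquiv (θ n) ((T.X n).presheaf.stalkCongr (.of_eq (hpt n))).commRingCatIsoToRingEquiv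

/-- **Each stage's image is DOMINATED by the next one** (`π_n^♯` is a local homomorphism and the embeddings are compatible).
[cite: Cutkosky2014, §2.1] -/
theorem subringDominates_range_succ (hinj : ∀ n, Function.Injective (θ n))
    (hcomp : ∀ n, (θ (n + 1)).comp ((T.π n).stalkMap (pt (n + 1))).hom =
      (θ n).comp ((T.X n).presheaf.stalkCongr (.of_eq (hpt n))).hom.hom) (n : ℕ) :
    SubringDominates (θ n).range (θ (n + 1)).range := by
  have hc : ∀ a, θ (n + 1) (((T.π n).stalkMap (pt (n + 1))).hom (((T.X n).presheaf.stalkCongr (.of_eq (hpt n))).inv.hom a)) = θ n a := by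
    intro a
    have h1 := RingHom.congr_fun (hcomp n) (((T.X n).presheaf.stalkCongr (.of_eq (hpt n))).inv.hom a)
    simp only [RingHom.comp_apply] at h1
    rw [h1, ← CommRingCat.comp_apply, Iso.inv_hom_id, CommRingCat.id_apply]
  refine ⟨?_, ?_⟩
  · rintro _ ⟨a, rfl⟩
    exact ⟨_, hc a⟩
  · rintro z ⟨a, rfl⟩ ⟨b, hb⟩
    -- `θ n a` is invertible in the upper image: then `a` is a unit of the lower stalk
    by_cases ha0 : θ n a = 0
    · rw [ha0, inv_zero]; exact (θ n).range.zero_mem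
    have hunit : IsUnit (((T.π n).stalkMap (pt (n + 1))).hom (((T.X n).presheaf.stalkCongr (.of_eq (hpt n))).inv.hom a)) := by
      refine IsUnit.of_mul_eq_one b (hinj (n + 1) ?_)
      rw [map_mul, hc a, hb, map_one, mul_inv_cancel₀ ha0]
    have hunit' : IsUnit (((T.X n).presheaf.stalkCongr (.of_eq (hpt n))).inv.hom a) :=
      (isUnit_map_iff ((T.π n).stalkMap (pt (n + 1))).hom _).mp hunit
    have hunita : IsUnit a := by
      have h2 := hunit'.map ((T.X n).presheaf.stalkCongr (.of_eq (hpt n))).hom.hom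
      rwa [← CommRingCat.comp_apply, Iso.inv_hom_id, CommRingCat.id_apply] at h2
    obtain ⟨v, hv⟩ := hunita
    refine ⟨(↑v⁻¹ : (T.X n).presheaf.stalk (pt n)), ?_⟩
    rw [← hv]
    refine eq_inv_of_mul_eq_one_left ?_
    rw [← map_mul, Units.inv_mul, map_one]

/-- **A VALUATION RING DOMINATING EVERY STAGE, ALONG WHICH EVERY STEP IS THE QUADRATIC TRANSFORM.** Tower of blow-ups `T` with integral
stages, POINT centres `C_n = {pt n}`, marked CLOSED points `pt (n+1) ↦ pt n`, and a compatible family of injective stalk embeddings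
`θ n : 𝒪_{X_n,pt n} ↪ L`: Chevalley (res-type-026's `exists_valuationSubring_dominates` on the dominating chain of images) gives `O`, and §1
gives the quadratic transforms — the tower shape `IsQuadraticTransformAlong O (T i) (T (i+1))` of `false_of_hsIsolated_singular_pointTower_of_CP`.
[cite: StacksProject, Tag 0804] [cite: Cutkosky2014, §2.2] [cite: Matsumura1987, Thm. 10.2] -/
theorem exists_valuation_forall_isQuadraticTransformAlong_of_pointTower
    (hint : ∀ n, IsIntegral (T.X n)) (hC : ∀ n, T.C n = {pt n}) (hcl : ∀ n, IsClosed ({pt n} : Set (T.X n)))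
    (hinj : ∀ n, Function.Injective (θ n))
    (hcomp : ∀ n, (θ (n + 1)).comp ((T.π n).stalkMap (pt (n + 1))).hom =
      (θ n).comp ((T.X n).presheaf.stalkCongr (.of_eq (hpt n))).hom.hom) :
    ∃ O : ValuationSubring L, (∀ n, SubringDominates (θ n).range O.toSubring) ∧
      ∀ n, IsQuadraticTransformAlong O (θ n).range (θ (n + 1)).range := by
  haveI : ∀ n, IsLocalRing (θ n).range := fun n => by
    haveI := T.ln n
    exact isLocalRing_of_range_eq (θ n) _ rfl
  obtain ⟨O, hO⟩ := exists_valuationSubring_dominates (fun n => (θ n).range) (subringDominates_range_succ hpt θ hinj hcomp)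
  refine ⟨O, hO, fun n => ?_⟩
  haveI := T.ln n
  haveI := T.ln (n + 1)
  haveI := hint n
  -- the centre ideal at the image point is the maximal ideal
  have hJ : stalkIdeal (vanishingIdeal ⟨T.C n, T.isClosed_C n⟩) ((T.π n) (pt (n + 1))) =
      maximalIdeal ((T.X n).presheaf.stalk ((T.π n) (pt (n + 1)))) := by
    refine stalkIdeal_vanishingIdeal_eq_maximalIdeal_of_closure_eq ?_
    change T.C n = closure {(T.π n).base (pt (n + 1))}
    rw [hpt n, (hcl n).closure_eq, hC n]
  have hstep := isQuadraticTransformAlong_range_of_stalk_embeddings (L := L) (T.isBlowup n) (pt (n + 1)) hJ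
    ((θ n).comp ((T.X n).presheaf.stalkCongr (.of_eq (hpt n))).hom.hom) (injective_comp_stalkCongr hpt θ hinj n) (θ (n + 1))
    (hcomp n) O (hO (n + 1))
  rwa [range_comp_stalkCongr hpt θ n] at hstep

/-- The same for an ISOLATED E3 POINT TOWER (`IsIsoPointTower`: its centre / marked-point / closedness clauses are the tower hypotheses above).
[cite: CossartJannsenSaito2020, Def. 6.34, Def. 6.38] [cite: Cutkosky2014, §2.2] -/
theorem exists_valuation_forall_isQuadraticTransformAlong_of_isIsoPointTower {N : ℕ} {ν : ℕ → ℕ}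
    (hT : IsIsoPointTower N ν T pt) (hint : ∀ n, IsIntegral (T.X n))
    (θ : ∀ n, (T.X n).presheaf.stalk (pt n) →+* L) (hinj : ∀ n, Function.Injective (θ n))
    (hcomp : ∀ n, (θ (n + 1)).comp ((T.π n).stalkMap (pt (n + 1))).hom =
      (θ n).comp ((T.X n).presheaf.stalkCongr (.of_eq (hT.2.1 n))).hom.hom) :
    ∃ O : ValuationSubring L, (∀ n, SubringDominates (θ n).range O.toSubring) ∧
      ∀ n, IsQuadraticTransformAlong O (θ n).range (θ (n + 1)).range :=
  exists_valuation_forall_isQuadraticTransformAlong_of_pointTower hT.2.1 θ hint hT.1 hT.2.2.1 hinj hcomp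

end Tower

end Summit.ResolutionOfSingularities.ResolutionOfSingularities.Cruxes.SigmaMaxModifications.IdeasL1C5

end
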